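import Literature.NumberTheory.Sieve.LinearEquationsInPrimesGvNLinearForms
import Literature.NumberTheory.Sieve.LinearEquationsInPrimesSingularSeries
import Literature.NumberTheory.Sieve.LinearEquationsInPrimesWTrick
import HarnessLib

/-!
# The generalised von Neumann theorem: mollified box averages (Green–Tao 2010, App. C)

Trunk T-SIEVE (`Literature/NumberTheory/Sieve`). Fifth file of the App. B/C layer of the
decomposition of `Literature.NumberTheory.Sieve.GreenTaoZiegler2012_finiteComplexity`, towards the discharge of
`Literature.NumberTheory.Sieve.GreenTao2010_generalisedVonNeumann` (Prop. 7.1 of B. Green, T. Tao, *Linear equations in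
primes*, Ann. of Math. 171 (2010)), completed in `LinearEquationsInPrimesGvN.lean`. This file
proves the estimate for a single *mollified multilinear average over `ℤ_{N'}^d`*
(`Literature.NumberTheory.Sieve.box_bound`, the analogue of Proposition 7.1″ of App. C with a smooth product cutoff):

* consequences of the linear forms condition (Def. 6.2): the measure `ν♯ = (1 + ν)/2` again
  satisfies it (`Literature.NumberTheory.Sieve.linearFormsCondition_nuSharp`, "easily seen to be a pseudorandom measure"),
  restricted systems (`Literature.NumberTheory.Sieve.IntFormSys.restrict`), single-copy averages, and
  `|‖ν - 1‖_{U^k}^{2^k}| ≤ 2^{2^k} η` (`Literature.NumberTheory.Sieve.abs_gowersPower_sub_one_le`, "a standard application of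
  the linear forms condition");
* the split system of a system of affine forms in normal form at a distinguished index
  (`Literature.NumberTheory.Sieve.Splitting`, `Literature.NumberTheory.Sieve.splitOf`: "by permuting the basis vectors"), with the transfer of finite
  complexity, non-degeneracy, the normal-form properties, the coefficient bound, and the
  invertibility of the private coefficients modulo a prime `N' > L`;
* one-dimensional smoothing: trapezoids `1_I ∗ μ_q ∗ μ_{-q}` on `ℤ` (`Literature.NumberTheory.Sieve.trapZ`), the smooth
  partition of unity subordinate to a grid (`Literature.NumberTheory.Sieve.sum_trapZ_gridIco`), their transfer to the
  smoothed progression cutoffs `Literature.NumberTheory.Sieve.apSmooth` on `ℤ_{N'}` (`Literature.NumberTheory.Sieve.apSmooth_zmodInd_intCast`), and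
  the control of a correlation along a unit-step progression by `‖·‖_{U²}`
  (`Literature.NumberTheory.Sieve.expect_affine_mul_apSmooth_pow_four_le`) — the Fourier-free replacement for the
  Lipschitz cutoffs and the Fourier expansion (C.1) of the source;
* the two cases of the mollified multilinear average bound: `|J| ≥ 2` private coordinates
  (`Literature.NumberTheory.Sieve.box_nondegenerate`, from `SplitSys.coreGvN_concrete`) and a single private coordinate
  (`Literature.NumberTheory.Sieve.box_degenerate`, by factorisation), combined in `Literature.NumberTheory.Sieve.box_bound` with the explicit error
  `Literature.boxErr s η δ₁ (N'/q)` and degree `Literature.boxDegree s t d L`.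

## References

* B. Green, T. Tao, *Linear equations in primes*, Ann. of Math. (2) 171 (2010), 1753–1850
  (arXiv:math/0606088): Prop. 7.1, App. C (Propositions 7.1′, 7.1″, the main argument, the
  remarks on `ν♯` and on `‖ν - 1‖_{U^{s+1}}`), Def. 4.2 (normal form), Def. 6.2 (linear forms
  condition), App. B (monotonicity of Gowers norms).
-/

noncomputable section

open Finset
open scoped BigOperators

namespace Literature.NumberTheory.Sieve

/-! ### Consequences of the linear forms condition -/

section lfcconseq

namespace IntFormSys

variable {Φ V : Type*}

/-- Restriction of a formal system to a subset of its forms. [folklore] -/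
def restrict (S : IntFormSys Φ V) (T : Finset Φ) : IntFormSys T V where
  coeff φ := S.coeff φ.1
  const φ := S.const φ.1

/-- Restriction preserves finite complexity. [cite: GreenTao2010, §1 (subsystems)] -/
theorem restrict_fc {S : IntFormSys Φ V} (h : S.FiniteComplexity) (T : Finset Φ) :
    (S.restrict T).FiniteComplexity :=
  fun φ φ' hne a b hab => h φ.1 φ'.1 (fun e => hne (Subtype.ext e)) a b hab

/-- Restriction preserves non-constancy. [folklore] -/
theorem restrict_nz {S : IntFormSys Φ V} (h : S.Nonzero) (T : Finset Φ) : (S.restrict T).Nonzero :=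
  fun φ => h φ.1

/-- Restriction preserves coefficient bounds. [folklore] -/
theorem restrict_bound {S : IntFormSys Φ V} {L : ℕ} (h : S.CoeffBound L) (T : Finset Φ) :
    (S.restrict T).CoeffBound L :=
  fun φ c => h φ.1 c

/-- The forms of the restriction. [folklore] -/
theorem restrict_evalZ [Fintype V] (S : IntFormSys Φ V) (T : Finset Φ) (M : ℕ) (φ : T)
    (v : V → ZMod M) : (S.restrict T).evalZ M φ v = S.evalZ M φ.1 v := rfl

end IntFormSys

variable {M : ℕ} [NeZero M]

/-- The measure `ν♯ = (1 + ν)/2` ("the function `½(ν+1)` … is easily seen to be a pseudorandom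
measure"). [cite: GreenTao2010, App. C (Removing the convex cutoff)] -/
def nuSharp (ν : ZMod M → ℝ) (x : ZMod M) : ℝ := (1 + ν x) / 2

omit [NeZero M] in
/-- `|ν - 1|/2 ≤ ν♯` for `ν ≥ 0`. [cite: GreenTao2010, App. C ("`½|ν(x)-1| ≤ ½(ν(x)+1)`")] -/
theorem abs_half_sub_le_nuSharp {ν : ZMod M → ℝ} (hν : ∀ x, 0 ≤ ν x) (x : ZMod M) :
    |(ν x - 1) / 2| ≤ nuSharp ν x := by
  unfold nuSharp
  rw [abs_div, abs_two]
  refine div_le_div_of_nonneg_right ?_ zero_le_two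
  have := hν x
  rw [abs_le]; constructor <;> linarith

omit [NeZero M] in
/-- `ν♯ ≥ 0` for `ν ≥ 0`. [folklore] -/
theorem nuSharp_nonneg {ν : ZMod M → ℝ} (hν : ∀ x, 0 ≤ ν x) (x : ZMod M) : 0 ≤ nuSharp ν x := by
  unfold nuSharp; have := hν x; positivity

omit [NeZero M] in
/-- `ν♯ - 1 = (ν - 1)/2`. [folklore] -/
theorem nuSharp_sub_one (ν : ZMod M → ℝ) (x : ZMod M) : nuSharp ν x - 1 = (ν x - 1) / 2 := by
  unfold nuSharp; ring

/-- The linear forms average of a subsystem, as an average. [folklore] -/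
theorem linearFormsAverage_comp_eq {d t : ℕ} (ν : ZMod M → ℝ) (Ψ : Fin t → AffLinForm d)
    (T : Finset (Fin t)) (e : Fin T.card ≃ T) :
    linearFormsAverage ν (Ψ ∘ (fun i => (e i).1)) =
      𝔼 n : Fin d → ZMod M, ∏ i ∈ T, ν ((Ψ i).modEval M n) := by
  unfold linearFormsAverage
  rw [Fintype.expect_eq_sum_div_card, Fintype.card_fun, ZMod.card, Fintype.card_fin, Nat.cast_pow]
  congr 1
  refine Fintype.sum_congr _ _ fun n => ?_
  rw [← Finset.prod_coe_sort T, ← Fintype.prod_equiv e]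
  intro i; rfl

/-- **`ν♯` satisfies the linear forms condition when `ν` does** (same parameters and error):
`𝔼 ∏ (1 + ν(ψ_i))/2 = 2^{-t} ∑_S 𝔼 ∏_{i∈S} ν(ψ_i)` and subsystems of finite-complexity systems
have finite complexity. [cite: GreenTao2010, App. C ("this latter function is easily seen to
be a pseudorandom measure")] -/
theorem linearFormsCondition_nuSharp {m₀ d₀ L₀ : ℕ} {η : ℝ} {ν : ZMod M → ℝ}
    (h : LinearFormsCondition m₀ d₀ L₀ η ν) (hη : 0 ≤ η) :
    LinearFormsCondition m₀ d₀ L₀ η (nuSharp ν) := by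
  intro d t hd1 hdd ht1 htm Ψ hΨ hfc hco
  -- expand the product
  have hpt : ∀ n : Fin d → ZMod M, ∏ i, nuSharp ν ((Ψ i).modEval M n) =
      (∑ T : Finset (Fin t), ∏ i ∈ T, ν ((Ψ i).modEval M n)) / 2 ^ t := by
    intro n
    unfold nuSharp
    rw [Finset.prod_div_distrib, Finset.prod_const, Finset.card_univ, Fintype.card_fin]
    congr 1
    rw [Finset.prod_congr rfl fun i _ => add_comm (1 : ℝ) (ν ((Ψ i).modEval M n)),
      Fintype.prod_add]
    simp
  have hexp : linearFormsAverage (nuSharp ν) Ψ =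
      (∑ T : Finset (Fin t), 𝔼 n : Fin d → ZMod M, ∏ i ∈ T, ν ((Ψ i).modEval M n)) / 2 ^ t := by
    unfold linearFormsAverage
    simp_rw [hpt]
    rw [← Finset.sum_div, div_div, mul_comm ((2 : ℝ) ^ t), ← div_div, Finset.sum_comm,
      Finset.sum_div]
    congr 1
    refine Finset.sum_congr rfl fun T _ => ?_
    rw [Fintype.expect_eq_sum_div_card, Fintype.card_fun, ZMod.card, Fintype.card_fin, Nat.cast_pow]
  rw [hexp]
  -- each subsystem average is `1 + O(η)`; the empty one is `1`
  have hT : ∀ T : Finset (Fin t),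
      |(𝔼 n : Fin d → ZMod M, ∏ i ∈ T, ν ((Ψ i).modEval M n)) - 1| ≤ η := by
    intro T
    rcases T.eq_empty_or_nonempty with rfl | hne
    · simp only [Finset.prod_empty, Fintype.expect_const, sub_self, abs_zero]; exact hη
    · let e : Fin T.card ≃ T := (finCongr (Fintype.card_coe T).symm).trans (Fintype.equivFin T).symm
      have hinj : Function.Injective (fun i : Fin T.card => (e i).1) :=
        fun i j hij => e.injective (Subtype.ext hij)
      have htT : T.card ≤ m₀ := (Finset.card_le_univ T).trans (by rw [Fintype.card_fin]; exact htm)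
      rw [← linearFormsAverage_comp_eq ν Ψ T e]
      exact h d T.card hd1 hdd hne.card_pos htT _ (hΨ.comp_of_injective hinj)
        (fun i j hij a b hab => hfc _ _ (fun hh => hij (hinj hh)) a b hab) fun i j => hco _ _
  have hcard : ((Finset.univ : Finset (Finset (Fin t))).card : ℝ) = 2 ^ t := by
    rw [Finset.card_univ, Fintype.card_finset, Fintype.card_fin]; push_cast; ring
  have key : (∑ T : Finset (Fin t), 𝔼 n : Fin d → ZMod M, ∏ i ∈ T, ν ((Ψ i).modEval M n)) / 2 ^ t - 1
      = (∑ T : Finset (Fin t), ((𝔼 n : Fin d → ZMod M, ∏ i ∈ T, ν ((Ψ i).modEval M n)) - 1)) / 2 ^ t := by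
    rw [Finset.sum_sub_distrib, Finset.sum_const, nsmul_eq_mul, mul_one, hcard, sub_div,
      div_self (by positivity)]
  rw [key, abs_div, abs_of_pos (by positivity : (0 : ℝ) < 2 ^ t), div_le_iff₀ (by positivity)]
  calc |∑ T : Finset (Fin t), ((𝔼 n : Fin d → ZMod M, ∏ i ∈ T, ν ((Ψ i).modEval M n)) - 1)|
      ≤ ∑ T : Finset (Fin t), |(𝔼 n : Fin d → ZMod M, ∏ i ∈ T, ν ((Ψ i).modEval M n)) - 1| :=
        Finset.abs_sum_le_sum_abs _ _
    _ ≤ ∑ _T : Finset (Fin t), η := Finset.sum_le_sum fun T _ => hT T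
    _ = η * 2 ^ t := by rw [Finset.sum_const, nsmul_eq_mul, hcard, mul_comm]

end lfcconseq

/-! ### Single-copy averages and the Gowers norm of `ν - 1` -/

section singlecopy

variable {k d' t : ℕ} (S : SplitSys k d' t) {N' : ℕ} [NeZero N']

/-- The split system itself as a formal system. [folklore] -/
def SplitSys.sysSingle : IntFormSys (Fin t) (SplitIdx k d') where
  coeff := S.c
  const := S.κ

/-- **Single-copy averages are `1 + O(η)`**: `|𝔼_p ∏_{i ∈ T} ν(θ_i p) - 1| ≤ η` for non-empty
`T ⊆ [t]`, under the `(D,D,D)`-linear forms condition with `D ≥ t, k + d', L`.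
[cite: GreenTao2010, Def. 6.2] -/
theorem SplitSys.abs_expect_prod_θ_sub_one_le {D₀ L : ℕ} {η : ℝ} {ν₀ : ZMod N' → ℝ}
    (hLFC : LinearFormsCondition D₀ D₀ D₀ η ν₀) (hfc : S.FC) (hnz : S.NZ) (hB : S.Bound L)
    (hLD : L ≤ D₀) (ht : t ≤ D₀) (hkd1 : 1 ≤ k + d') (hkd : k + d' ≤ D₀)
    (T : Finset (Fin t)) (hT : T.Nonempty) :
    |(𝔼 p : SplitIdx k d' → ZMod N', ∏ i ∈ T, ν₀ (S.θ N' i p)) - 1| ≤ η := by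
  have h := (S.sysSingle.restrict T).abs_expect_prod_sub_one_le hLFC
    (IntFormSys.restrict_fc (fun i i' hii a b hab => hfc i i' hii a b hab) T)
    (IntFormSys.restrict_nz (fun i => hnz i) T) (IntFormSys.restrict_bound (fun i c => hB i c) T)
    hLD (by rw [Fintype.card_coe]; exact hT.card_pos)
    (by rw [Fintype.card_coe]; exact (Finset.card_le_univ T).trans (by rw [Fintype.card_fin]; exact ht))
    (by rw [Fintype.card_sum, Fintype.card_fin, Fintype.card_fin]; exact hkd1)
    (by rw [Fintype.card_sum, Fintype.card_fin, Fintype.card_fin]; exact hkd)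
  have hp : ∀ p : SplitIdx k d' → ZMod N', ∏ φ : T, ν₀ ((S.sysSingle.restrict T).evalZ N' φ p) =
      ∏ i ∈ T, ν₀ (S.θ N' i p) := fun p => by
    rw [← Finset.prod_coe_sort T]; rfl
  simp_rw [hp] at h
  exact h

/-- The trivial split system with `c_{i₀}(x_j) = 1`, whose `sysA₀` is the cube system
`{z + ∑_{j∈ω} h_j}`. [folklore] -/
def cubeSplitSys (k : ℕ) : SplitSys k 0 1 where
  c _ v := Sum.elim (fun _ => 1) (fun _ => 0) v
  κ _ := 0
  i₀ := 0

/-- `‖ν‖_{U^k}^{2^k} = A₀` for the trivial split system. [folklore] -/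
theorem gowersPower_eq_topA₀_cube (ν₀ : ZMod N' → ℝ) :
    gowersPower k ν₀ = topA₀ ν₀ ((cubeSplitSys k).a N') := by
  unfold topA₀ topV gowersPower
  refine Finset.expect_congr rfl fun q _ => ?_
  simp [SplitSys.a, cubeSplitSys]

/-- **`‖ν - 1‖_{U^k(ℤ_{N'})}` is small under the linear forms condition**: expanding the product
over the `2^k` vertices, `|‖ν - 1‖_{U^k}^{2^k}| ≤ 2^{2^k} η` ("a standard application of the linear
forms condition gives `‖ν - 1‖_{U^{s+1}(ℤ_{N'})} = o(1)`").
[cite: GreenTao2010, App. C (Removing the convex cutoff)] -/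
theorem abs_gowersPower_sub_one_le {D₀ : ℕ} {η : ℝ} {ν₀ : ZMod N' → ℝ}
    (hLFC : LinearFormsCondition D₀ D₀ D₀ η ν₀) (hη : 0 ≤ η) (hk : 2 ^ k ≤ D₀) (hk' : k + 1 ≤ D₀)
    (h1 : 1 ≤ D₀) :
    |gowersPower k (fun x => ν₀ x - 1)| ≤ 2 ^ (2 ^ k) * η := by
  set C := cubeSplitSys k with hC
  have hT : C.Top := fun j => by simp [hC, cubeSplitSys]
  have hBd : C.Bound 1 := by
    intro i v; rcases v with j | m
    · simp [hC, cubeSplitSys]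
    · exact m.elim0
  -- expand `∏_ω (ν(v_ω) - 1)`
  rw [gowersPower_eq_topA₀_cube, C.topA₀_eq]
  have hexp : ∀ v : Unit ⊕ Fin k → ZMod N',
      ∏ ω, (ν₀ (C.sysA₀.evalZ N' ω v) - 1) =
        ∑ T : Finset (Finset (Fin k)), (∏ ω ∈ T, ν₀ (C.sysA₀.evalZ N' ω v)) * (-1) ^ Tᶜ.card := by
    intro v
    simp_rw [sub_eq_add_neg]
    rw [Fintype.prod_add]
    refine Fintype.sum_congr _ _ fun T => ?_
    rw [Finset.prod_const]
  simp_rw [hexp]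
  rw [Finset.expect_sum_comm]
  -- `∑_T (-1)^{|Tᶜ|} = 0`
  have hzero : ∑ T : Finset (Finset (Fin k)), ((-1 : ℝ)) ^ Tᶜ.card = 0 := by
    have := Fintype.prod_add (fun _ : Finset (Fin k) => (1 : ℝ)) (fun _ => (-1 : ℝ))
    simp only [add_neg_cancel, Finset.prod_const_one, one_mul, Finset.prod_const] at this
    rw [← this, Finset.card_univ]
    exact zero_pow Fintype.card_ne_zero
  have hsplit : ∑ T : Finset (Finset (Fin k)), (𝔼 v : Unit ⊕ Fin k → ZMod N',
      (∏ ω ∈ T, ν₀ (C.sysA₀.evalZ N' ω v)) * (-1) ^ Tᶜ.card) =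
      ∑ T : Finset (Finset (Fin k)), ((𝔼 v : Unit ⊕ Fin k → ZMod N',
        ∏ ω ∈ T, ν₀ (C.sysA₀.evalZ N' ω v)) - 1) * (-1) ^ Tᶜ.card := by
    rw [← sub_zero (∑ T : Finset (Finset (Fin k)), (𝔼 v : Unit ⊕ Fin k → ZMod N',
      (∏ ω ∈ T, ν₀ (C.sysA₀.evalZ N' ω v)) * (-1) ^ Tᶜ.card)), ← hzero, ← Finset.sum_sub_distrib]
    refine Fintype.sum_congr _ _ fun T => ?_
    rw [← Finset.expect_mul]; ring
  rw [hsplit]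
  -- each term is at most `η`
  have hterm : ∀ T : Finset (Finset (Fin k)),
      |((𝔼 v : Unit ⊕ Fin k → ZMod N', ∏ ω ∈ T, ν₀ (C.sysA₀.evalZ N' ω v)) - 1) * (-1) ^ Tᶜ.card| ≤ η := by
    intro T
    rw [abs_mul, abs_pow, abs_neg, abs_one, one_pow, mul_one]
    rcases T.eq_empty_or_nonempty with rfl | hne
    · simp only [Finset.prod_empty, Fintype.expect_const, sub_self, abs_zero]; exact hη
    · have hTk : T.card ≤ D₀ := (Finset.card_le_univ T).trans
        (by rw [Fintype.card_finset, Fintype.card_fin]; exact hk)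
      have h := (C.sysA₀.restrict T).abs_expect_prod_sub_one_le hLFC
        (IntFormSys.restrict_fc (C.sysA₀_fc hT) T) (IntFormSys.restrict_nz C.sysA₀_nz T)
        (IntFormSys.restrict_bound (C.sysA₀_bound le_rfl hBd) T) h1
        (by rw [Fintype.card_coe]; exact hne.card_pos)
        (by rw [Fintype.card_coe]; exact hTk)
        (by rw [Fintype.card_sum, Fintype.card_unique, Fintype.card_fin]; omega)
        (by rw [Fintype.card_sum, Fintype.card_unique, Fintype.card_fin]; omega)
      have hp : ∀ v : Unit ⊕ Fin k → ZMod N', ∏ φ : T, ν₀ ((C.sysA₀.restrict T).evalZ N' φ v) =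
          ∏ ω ∈ T, ν₀ (C.sysA₀.evalZ N' ω v) := fun v => by
        rw [← Finset.prod_coe_sort T]; rfl
      simp_rw [hp] at h
      exact h
  refine (Finset.abs_sum_le_sum_abs _ _).trans ((Finset.sum_le_sum fun T _ => hterm T).trans ?_)
  rw [Finset.sum_const, Finset.card_univ, Fintype.card_finset, Fintype.card_finset, Fintype.card_fin,
    nsmul_eq_mul]
  push_cast
  rfl

end singlecopy

/-! ### Split systems from a system of affine forms in normal form -/

section splitof

variable {d t : ℕ}

/-- A splitting of the coordinates `[d]` into `k` private ones (the set `J`) and `d'` others: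
a bijection `σ : [d] ≃ [k] ⊔ [d']` with `σ(J) = [k]`.
[cite: GreenTao2010, App. C ("By permuting the basis vectors `e₁,…,e_d` if necessary")] -/
structure Splitting (d k d' : ℕ) where
  /-- the bijection -/
  σ : Fin d ≃ SplitIdx k d'
  /-- the private set -/
  J : Finset (Fin d)
  /-- `σ.symm (inl j) ∈ J` -/
  symm_inl_mem : ∀ j, σ.symm (Sum.inl j) ∈ J
  /-- `σ e` is private for `e ∈ J` -/
  mem_range : ∀ e ∈ J, ∃ j, σ e = Sum.inl j

/-- Existence of a splitting with a prescribed private set. [folklore] -/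
theorem exists_splitting (J : Finset (Fin d)) :
    ∃ Sp : Splitting d J.card (d - J.card), Sp.J = J := by
  classical
  let eJ : {x // x ∈ J} ≃ Fin J.card :=
    (Fintype.equivFin _).trans (finCongr (Fintype.card_coe J))
  have hc : Fintype.card {x // ¬ x ∈ J} = d - J.card := by
    rw [Fintype.card_subtype_compl, Fintype.card_fin, Fintype.card_coe]
  let eJc : {x // ¬ x ∈ J} ≃ Fin (d - J.card) := (Fintype.equivFin _).trans (finCongr hc)
  let σ : Fin d ≃ SplitIdx J.card (d - J.card) :=
    (Equiv.sumCompl (· ∈ J)).symm.trans (Equiv.sumCongr eJ eJc)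
  refine ⟨⟨σ, J, fun j => ?_, fun e he => ?_⟩, rfl⟩
  · show ((Equiv.sumCompl (· ∈ J)) ((Equiv.sumCongr eJ eJc).symm (Sum.inl j))) ∈ J
    simp
  · refine ⟨eJ ⟨e, he⟩, ?_⟩
    show (Equiv.sumCongr eJ eJc) ((Equiv.sumCompl (· ∈ J)).symm e) = _
    have : (Equiv.sumCompl (· ∈ J)).symm e = Sum.inl ⟨e, he⟩ := by
      apply (Equiv.sumCompl (· ∈ J)).injective
      simp
    rw [this]
    rfl

variable {k d' : ℕ}

/-- The split system of `Ψ` for a splitting and a distinguished index.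
[cite: GreenTao2010, App. C (Main argument)] -/
def splitOf (Ψ : Fin t → AffLinForm d) (i₀ : Fin t) (Sp : Splitting d k d') : SplitSys k d' t where
  c i v := (Ψ i).coeff (Sp.σ.symm v)
  κ i := (Ψ i).const
  i₀ := i₀

/-- The forms of the split system are the reductions of the original forms, in permuted
coordinates: `θ_i(n ∘ σ⁻¹) = ψ_i(n) mod N'`. [folklore] -/
theorem splitOf_θ (Ψ : Fin t → AffLinForm d) (i₀ : Fin t) (Sp : Splitting d k d') (N' : ℕ)
    (i : Fin t) (n : Fin d → ZMod N') :
    (splitOf Ψ i₀ Sp).θ N' i (fun v => n (Sp.σ.symm v)) = (Ψ i).modEval N' n := by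
  unfold SplitSys.θ splitOf AffLinForm.modEval
  congr 1
  exact Fintype.sum_equiv Sp.σ.symm _ _ fun v => rfl

/-- Finite complexity transfers. [folklore] -/
theorem splitOf_fc {Ψ : Fin t → AffLinForm d} (h : IsFiniteComplexitySystem Ψ) (i₀ : Fin t)
    (Sp : Splitting d k d') : (splitOf Ψ i₀ Sp).FC := by
  intro i i' hii a b hab
  refine h i i' hii a b ?_
  funext e
  have := congr_fun hab (Sp.σ e)
  simpa [splitOf] using this

/-- Non-constancy transfers. [folklore] -/
theorem splitOf_nz {Ψ : Fin t → AffLinForm d} (h : IsNondegenerateSystem Ψ) (i₀ : Fin t)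
    (Sp : Splitting d k d') : (splitOf Ψ i₀ Sp).NZ := by
  intro i hc
  apply h.1 i
  funext e
  have := congr_fun hc (Sp.σ e)
  simpa [splitOf] using this

/-- The distinguished form involves all private coordinates when `∏_{e ∈ J} ψ̇_{i₀}(e) ≠ 0`.
[cite: GreenTao2010, Def. 4.2 and App. C] -/
theorem splitOf_top {Ψ : Fin t → AffLinForm d} {i₀ : Fin t} (Sp : Splitting d k d')
    (h : ∏ e ∈ Sp.J, (Ψ i₀).coeff e ≠ 0) : (splitOf Ψ i₀ Sp).Top := by
  intro j
  exact Finset.prod_ne_zero_iff.mp h _ (Sp.symm_inl_mem j)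

/-- Every other form misses a private coordinate when `∏_{e ∈ J} ψ̇_i(e) = 0` for `i ≠ i₀`.
[cite: GreenTao2010, Def. 4.2 and App. C] -/
theorem splitOf_low {Ψ : Fin t → AffLinForm d} {i₀ : Fin t} (Sp : Splitting d k d')
    (h : ∀ i, i ≠ i₀ → ∏ e ∈ Sp.J, (Ψ i).coeff e = 0) : (splitOf Ψ i₀ Sp).Low := by
  intro i hi
  obtain ⟨e, he, h0⟩ := Finset.prod_eq_zero_iff.mp (h i hi)
  obtain ⟨j, hj⟩ := Sp.mem_range e he
  refine ⟨j, ?_⟩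
  show (Ψ i).coeff (Sp.σ.symm (Sum.inl j)) = 0
  rwa [← hj, Equiv.symm_apply_apply]

/-- The coefficient bound transfers from `‖Ψ‖_N ≤ L`. [cite: GreenTao2010, §3] -/
theorem splitOf_bound {Ψ : Fin t → AffLinForm d} {N : ℝ} {L : ℕ} (h : affLinSize Ψ N ≤ L)
    (i₀ : Fin t) (Sp : Splitting d k d') : (splitOf Ψ i₀ Sp).Bound L := by
  intro i v
  have := natAbs_coeff_le_of_affLinSize_le h i (Sp.σ.symm v)
  show |(Ψ i).coeff (Sp.σ.symm v)| ≤ L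
  rw [Int.abs_eq_natAbs]
  exact_mod_cast this

/-- A non-zero integer of size `< N'` is a unit modulo the prime `N'`. [folklore] -/
theorem isUnit_intCast_of_prime {N' : ℕ} (hp : N'.Prime) {c : ℤ} (hc : c ≠ 0) (hcN : |c| < N') :
    IsUnit (c : ZMod N') := by
  haveI : Fact N'.Prime := ⟨hp⟩
  rw [isUnit_iff_ne_zero, Ne, ZMod.intCast_zmod_eq_zero_iff_dvd]
  intro hdvd
  exact hc (Int.eq_zero_of_abs_lt_dvd hdvd hcN)

/-- The private coefficients of the split system are units modulo a prime `N' > L`.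
[cite: GreenTao2010, App. C ("the coefficients `ψ̇₁(e_j)` … are invertible in `ℤ_{N'}`")] -/
theorem splitOf_isUnit {Ψ : Fin t → AffLinForm d} {i₀ : Fin t} (Sp : Splitting d k d')
    (htop : ∏ e ∈ Sp.J, (Ψ i₀).coeff e ≠ 0) {N : ℝ} {L : ℕ} (hL : affLinSize Ψ N ≤ L) {N' : ℕ}
    (hp : N'.Prime) (hLN : L < N') (j : Fin k) : IsUnit ((splitOf Ψ i₀ Sp).a N' j) := by
  unfold SplitSys.a
  refine isUnit_intCast_of_prime hp (splitOf_top Sp htop j) ?_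
  have := splitOf_bound hL i₀ Sp i₀ (Sum.inl j)
  exact lt_of_le_of_lt this (by exact_mod_cast hLN)

end splitof

/-! ### One-dimensional smoothing: trapezoids on `ℤ` and their transfer to `ℤ_{N'}` -/

section smoothing1d

/-- The trapezoid `(1_I ∗ μ_q ∗ μ_{-q})(x) = q⁻² #{(j,j') ∈ [0,q)² : x - j + j' ∈ I}` of a finite set
of integers `I` (for `I` an interval of a grid of mesh `ρ ≥ 2q` these form a smooth partition of
unity on `ℤ` subordinate to the grid). (Fourier-free replacement for the Lipschitz cutoffs
`F_ε, G_ε` of Cor. A.3.) [folklore] -/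
def trapZ (I : Finset ℤ) (q : ℕ) (x : ℤ) : ℝ :=
  ((Finset.univ.filter fun jj : Fin q × Fin q => x - jj.1 + jj.2 ∈ I).card : ℝ) / (q : ℝ) ^ 2

/-- `0 ≤ trapZ ≤ 1`. [folklore] -/
theorem trapZ_nonneg (I : Finset ℤ) (q : ℕ) (x : ℤ) : 0 ≤ trapZ I q x := by
  unfold trapZ; positivity

/-- `trapZ ≤ 1`. [folklore] -/
theorem trapZ_le_one (I : Finset ℤ) (q : ℕ) (x : ℤ) : trapZ I q x ≤ 1 := by
  unfold trapZ
  rcases Nat.eq_zero_or_pos q with rfl | hq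
  · simp
  · rw [div_le_one (by positivity)]
    have := Finset.card_filter_le (Finset.univ : Finset (Fin q × Fin q))
      (fun jj : Fin q × Fin q => x - jj.1 + jj.2 ∈ I)
    rw [Finset.card_univ, Fintype.card_prod, Fintype.card_fin] at this
    have h' : ((Finset.univ.filter fun jj : Fin q × Fin q => x - jj.1 + jj.2 ∈ I).card : ℝ) ≤
        (q : ℝ) * q := by exact_mod_cast this
    rw [sq]; exact h'

/-- Support of the trapezoid of an interval: `trapZ [a, b) q x ≠ 0 ⇒ a - q < x < b + q`.
[folklore] -/
theorem trapZ_Ico_ne_zero {a b : ℤ} {q : ℕ} {x : ℤ} (h : trapZ (Finset.Ico a b) q x ≠ 0) :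
    a - q < x ∧ x < b + q := by
  unfold trapZ at h
  have hcard : (Finset.univ.filter fun jj : Fin q × Fin q => x - jj.1 + jj.2 ∈ Finset.Ico a b).card ≠ 0 := by
    intro h0; apply h; rw [h0]; simp
  obtain ⟨jj, hjj⟩ := Finset.card_ne_zero.mp hcard
  have hm := (Finset.mem_filter.mp hjj).2
  rw [Finset.mem_Ico] at hm
  have h1 : ((jj.1 : ℕ) : ℤ) < q := by exact_mod_cast jj.1.2
  have h2 : ((jj.2 : ℕ) : ℤ) < q := by exact_mod_cast jj.2.2
  constructor <;> omega

/-- The grid interval `I_m = [mρ, (m+1)ρ)`. [folklore] -/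
def gridIco (ρ : ℕ) (m : ℤ) : Finset ℤ := Finset.Ico (m * ρ) ((m + 1) * ρ)

/-- Each integer lies in exactly one grid interval, namely `m = ⌊z/ρ⌋`. [folklore] -/
theorem mem_gridIco_iff {ρ : ℕ} (hρ : 0 < ρ) {z m : ℤ} : z ∈ gridIco ρ m ↔ m = z / ρ := by
  unfold gridIco
  rw [Finset.mem_Ico]
  have hρ' : (0 : ℤ) < ρ := by exact_mod_cast hρ
  constructor
  · rintro ⟨h1, h2⟩
    refine le_antisymm ((Int.le_ediv_iff_mul_le hρ').mpr h1) ?_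
    have := (Int.ediv_lt_iff_lt_mul hρ').mpr h2
    omega
  · rintro rfl
    exact ⟨Int.ediv_mul_le z hρ'.ne', Int.lt_ediv_add_one_mul_self z hρ'⟩

/-- **Partition of unity**: `∑_m trapZ I_m q x = 1` as soon as the range of `m` contains the
grid indices of all the points `x - j + j'`. [folklore] -/
theorem sum_trapZ_gridIco {ρ : ℕ} (hρ : 0 < ρ) {q : ℕ} (hq : 0 < q) (x : ℤ) (Ms : Finset ℤ)
    (hMs : ∀ jj : Fin q × Fin q, (x - jj.1 + jj.2) / ρ ∈ Ms) :
    ∑ m ∈ Ms, trapZ (gridIco ρ m) q x = 1 := by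
  unfold trapZ
  rw [← Finset.sum_div]
  rw [div_eq_one_iff_eq (by positivity)]
  have : ∀ m ∈ Ms, ((Finset.univ.filter fun jj : Fin q × Fin q =>
      x - jj.1 + jj.2 ∈ gridIco ρ m).card : ℝ) =
      ∑ jj : Fin q × Fin q, if m = (x - jj.1 + jj.2) / ρ then (1 : ℝ) else 0 := by
    intro m _
    rw [Finset.card_filter]
    push_cast
    refine Finset.sum_congr rfl fun jj _ => ?_
    simp only [mem_gridIco_iff hρ]
  rw [Finset.sum_congr rfl this, Finset.sum_comm]
  have h2 : ∀ jj : Fin q × Fin q, ∑ m ∈ Ms, (if m = (x - jj.1 + jj.2) / ρ then (1 : ℝ) else 0) = 1 := by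
    intro jj
    rw [Finset.sum_ite_eq' Ms ((x - jj.1 + jj.2) / ρ) (fun _ => (1 : ℝ)), if_pos (hMs jj)]
  simp_rw [h2]
  rw [Finset.sum_const, Finset.card_univ, Fintype.card_prod, Fintype.card_fin, nsmul_eq_mul, mul_one]
  push_cast; ring

/-- The grid indices of points near `[-R, R]` lie in `[-(R+q)/ρ - 1, (R+q)/ρ]`; a convenient
superset. [folklore] -/
def gridRange (R : ℤ) (ρ q : ℕ) : Finset ℤ := Finset.Icc (-((R + q) / ρ) - 1) ((R + q) / ρ)

/-- The grid range contains the grid indices of `x - j + j'`, `|x| ≤ R`, `j, j' < q`. [folklore] -/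
theorem div_mem_gridRange {R : ℤ} {ρ q : ℕ} (hρ : 0 < ρ) {x : ℤ} (hx : |x| ≤ R)
    (jj : Fin q × Fin q) : (x - jj.1 + jj.2) / ρ ∈ gridRange R ρ q := by
  unfold gridRange
  rw [Finset.mem_Icc]
  have hρ' : (0 : ℤ) < ρ := by exact_mod_cast hρ
  have h1 : ((jj.1 : ℕ) : ℤ) < q := by exact_mod_cast jj.1.2
  have h2 : ((jj.2 : ℕ) : ℤ) < q := by exact_mod_cast jj.2.2
  rw [abs_le] at hx
  constructor
  · have : -(R + q) ≤ x - jj.1 + jj.2 := by omega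
    have h3 := Int.ediv_le_ediv hρ' this
    have h4 : -((R + q) / (ρ : ℤ)) - 1 ≤ (-(R + q)) / (ρ : ℤ) := by
      have := Int.lt_ediv_add_one_mul_self (R + q) hρ'
      have h5 : (-((R + q) / ρ) - 1) * ρ ≤ -(R + q) := by nlinarith
      exact (Int.le_ediv_iff_mul_le hρ').mpr h5
    exact h4.trans h3
  · exact Int.ediv_le_ediv hρ' (by omega)

variable {N' : ℕ} [NeZero N']

/-- The indicator of the image of a finite set of integers in `ℤ_{N'}`. [folklore] -/
def zmodInd (N' : ℕ) (I : Finset ℤ) (y : ZMod N') : ℝ :=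
  if y ∈ I.image (fun z : ℤ => (z : ZMod N')) then 1 else 0

omit [NeZero N'] in
/-- `|zmodInd| ≤ 1`. [folklore] -/
theorem abs_zmodInd_le (I : Finset ℤ) (y : ZMod N') : |zmodInd N' I y| ≤ 1 := by
  unfold zmodInd; split_ifs <;> simp

omit [NeZero N'] in
/-- `0 ≤ zmodInd`. [folklore] -/
theorem zmodInd_nonneg (I : Finset ℤ) (y : ZMod N') : 0 ≤ zmodInd N' I y := by
  unfold zmodInd; split_ifs <;> simp

omit [NeZero N'] in
/-- **Transfer**: the smoothed progression cutoff of the image of `I ⊆ [-R, R]` agrees with the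
trapezoid at the images of integers `|x| ≤ R` (no wraparound for `N' > 3R + q`). [folklore] -/
theorem apSmooth_zmodInd_intCast {I : Finset ℤ} {R : ℤ} (hI : ∀ z ∈ I, |z| ≤ R) {x : ℤ}
    (hx : |x| ≤ R) {q : ℕ} (hN : 3 * R + q < N') :
    apSmooth (zmodInd N' I) 1 q (x : ZMod N') = trapZ I q x := by
  unfold apSmooth trapZ apPoint
  rw [Fintype.expect_eq_sum_div_card, Fintype.card_prod, Fintype.card_fin]
  push_cast
  rw [sq]
  congr 1
  rw [Finset.card_filter]
  push_cast
  refine Finset.sum_congr rfl fun jj _ => ?_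
  unfold zmodInd
  simp only [mul_one]
  have key : ((x : ZMod N') - ((jj.1 : ℕ) : ZMod N') + ((jj.2 : ℕ) : ZMod N')) ∈
      I.image (fun z : ℤ => (z : ZMod N')) ↔ x - jj.1 + jj.2 ∈ I := by
    rw [Finset.mem_image]
    constructor
    · rintro ⟨z, hz, hzx⟩
      have h1 : ((jj.1 : ℕ) : ℤ) < q := by exact_mod_cast jj.1.2
      have h2 : ((jj.2 : ℕ) : ℤ) < q := by exact_mod_cast jj.2.2
      have hzI := hI z hz
      have : z = x - jj.1 + jj.2 := by
        refine int_eq_of_zmod_eq (N' := N') (by rw [hzx]; push_cast; ring) ?_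
        rw [abs_le] at hx hzI
        rw [abs_lt]; constructor <;> omega
      rw [← this]; exact hz
    · intro h
      exact ⟨_, h, by push_cast; ring⟩
  by_cases h : x - jj.1 + jj.2 ∈ I
  · rw [if_pos (key.mpr h), if_pos h]
  · rw [if_neg (fun h' => h (key.mp h')), if_neg h]

/-- The average of the image indicator is `|I|/N'` when the reduction is injective on `I`.
[folklore] -/
theorem expect_zmodInd {I : Finset ℤ} {R : ℤ} (hI : ∀ z ∈ I, |z| ≤ R) (hN : 2 * R < N') :
    𝔼 y : ZMod N', zmodInd N' I y = I.card / N' := by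
  rw [Fintype.expect_eq_sum_div_card, ZMod.card]
  congr 1
  unfold zmodInd
  rw [Finset.sum_boole]
  have : (Finset.univ.filter fun y : ZMod N' => y ∈ I.image (fun z : ℤ => (z : ZMod N'))) =
      I.image (fun z : ℤ => (z : ZMod N')) := by ext y; simp
  rw [this, Finset.card_image_of_injOn]
  intro z hz z' hz' hzz'
  have hz1 := hI z hz; have hz2 := hI z' hz'
  refine int_eq_of_zmod_eq (N' := N') hzz' ?_
  rw [abs_le] at hz1 hz2; rw [abs_lt]; constructor <;> omega

/-- The average of a smoothed cutoff is the average of the cutoff (`q ≥ 1`). [folklore] -/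
theorem expect_apSmooth (c : ZMod N' → ℝ) (a : ZMod N') {q : ℕ} (hq : 0 < q) :
    𝔼 y : ZMod N', apSmooth c a q y = 𝔼 y : ZMod N', c y := by
  unfold apSmooth
  rw [Finset.expect_comm]
  have : ∀ jj : Fin q × Fin q, 𝔼 y : ZMod N', c (y - apPoint a q jj.1 + apPoint a q jj.2) =
      𝔼 y : ZMod N', c y := fun jj => by
    have := expect_add_right c (-apPoint a q jj.1 + apPoint a q jj.2)
    refine Eq.trans (Finset.expect_congr rfl fun y _ => ?_) this
    congr 1; ring
  simp_rw [this]
  haveI : NeZero q := ⟨hq.ne'⟩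
  exact Fintype.expect_const _

/-- **The degenerate private coordinate**: a correlation of `g` along a unit-step progression
with a smoothed cutoff is controlled by `‖g‖_{U²}`:
`(𝔼_y g(a y + β) (c ∗ μ_q ∗ μ_{-q})(y))⁴ ≤ (N'/q) ‖g‖_{U²}^4` (reparametrise `z = a y + β` and apply
`expect_mul_apSmooth_pow_four_le` to the cutoff transported along the progression).
[folklore] -/
theorem expect_affine_mul_apSmooth_pow_four_le (g : ZMod N' → ℝ) {c : ZMod N' → ℝ}
    (hc : ∀ x, |c x| ≤ 1) {a : ZMod N'} (ha : IsUnit a) (β : ZMod N') {q : ℕ} (hq : 1 ≤ q)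
    (hqM : q ≤ N') :
    (𝔼 y : ZMod N', g (a * y + β) * apSmooth c 1 q y) ^ 4 ≤ (N' : ℝ) / q * gowersPower 2 g := by
  obtain ⟨u, hu⟩ := ha
  set ainv : ZMod N' := ((u⁻¹ : (ZMod N')ˣ) : ZMod N') with hainv_def
  have hainv : a * ainv = 1 := by rw [← hu, hainv_def, Units.mul_inv]
  have hainv' : ainv * a = 1 := by rw [mul_comm]; exact hainv
  have hunit : IsUnit ainv := ⟨u⁻¹, rfl⟩
  -- the transported cutoff
  set c' : ZMod N' → ℝ := fun w => c (ainv * (w - β)) with hc'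
  have hc'1 : ∀ w, |c' w| ≤ 1 := fun w => hc _
  -- substitute `y = ainv (z - β)`
  have hsub : (𝔼 y : ZMod N', g (a * y + β) * apSmooth c 1 q y) =
      𝔼 z : ZMod N', g z * apSmooth c' a q z := by
    rw [← expect_affine (fun y => g (a * y + β) * apSmooth c 1 q y) hunit (-(ainv * β))]
    refine Finset.expect_congr rfl fun z _ => ?_
    have hz : a * (ainv * z + -(ainv * β)) + β = z := by
      linear_combination (z - β) * hainv
    rw [hz]
    congr 1
    unfold apSmooth apPoint
    refine Finset.expect_congr rfl fun jj _ => ?_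
    simp only [hc', mul_one]
    congr 1
    linear_combination (((jj.1 : ℕ) : ZMod N') - ((jj.2 : ℕ) : ZMod N')) * hainv'
  rw [hsub]
  exact expect_mul_apSmooth_pow_four_le g hc'1 ⟨u, hu⟩ hq hqM

/-- Averages of products of functions of distinct coordinates factor. [folklore] -/
theorem expect_prod_coord {ι : Type*} [Fintype ι] [DecidableEq ι] (F : ι → ZMod N' → ℝ) :
    𝔼 x : ι → ZMod N', ∏ c, F c (x c) = ∏ c, 𝔼 y : ZMod N', F c y := by
  rw [Fintype.expect_eq_sum_div_card, Fintype.card_fun, ZMod.card]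
  simp_rw [Fintype.expect_eq_sum_div_card, ZMod.card]
  rw [Finset.prod_div_distrib, Finset.prod_const, Finset.card_univ, Nat.cast_pow, Fintype.prod_sum]

end smoothing1d

/-! ### The mollified multilinear average: the two cases of App. C -/

section boxlemma

variable {d t : ℕ} {N' : ℕ} [NeZero N']

/-- Reindexing an average over `ℤ_{N'}^d` through a splitting. [folklore] -/
theorem expect_comp_splitting {k d' : ℕ} (Sp : Splitting d k d') (F : (Fin d → ZMod N') → ℝ) :
    𝔼 n : Fin d → ZMod N', F n =
      𝔼 p : SplitIdx k d' → ZMod N', F (fun e => p (Sp.σ e)) := by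
  rw [← expect_comp_equiv (Equiv.arrowCongr Sp.σ (Equiv.refl (ZMod N')))]
  refine Finset.expect_congr rfl fun n _ => ?_
  congr 1
  funext e
  simp [Equiv.arrowCongr]

/-- `coreDegree` is monotone in the number of private and other coordinates. [folklore] -/
theorem coreDegree_mono {k k₂ d' d₂ t L : ℕ} (hk : k ≤ k₂) (hd : d' ≤ d₂) :
    coreDegree k d' t L ≤ coreDegree k₂ d₂ t L := by
  unfold coreDegree
  have h1 : 2 ^ k ≤ 2 ^ k₂ := Nat.pow_le_pow_right (by norm_num) hk
  have h2 : 2 ^ k * 2 ^ k * t ≤ 2 ^ k₂ * 2 ^ k₂ * t :=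
    Nat.mul_le_mul (Nat.mul_le_mul h1 h1) le_rfl
  omega

/-- Roots of the Gowers bound: `‖g‖_{U^k}^{2^k} ≤ δ₁^{2^k}` from `‖g‖_{U^{s+1}}^{2^{s+1}} ≤ δ₁^{2^{s+1}}`
for `1 ≤ k ≤ s + 1`. [cite: GreenTao2010, App. B (monotonicity of the Gowers norms)] -/
theorem gowersPower_le_of_le {s k : ℕ} (hk : 1 ≤ k) (hks : k ≤ s + 1) {g : ZMod N' → ℝ} {δ₁ : ℝ}
    (hδ : 0 ≤ δ₁) (h : gowersPower (s + 1) g ≤ δ₁ ^ 2 ^ (s + 1)) :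
    gowersPower k g ≤ δ₁ ^ 2 ^ k := by
  obtain ⟨m, hm⟩ : ∃ m, s + 1 = k + m := ⟨s + 1 - k, by omega⟩
  rw [hm] at h
  have h1 := gowersPower_pow_le_add hk m g
  have h2 : gowersPower k g ^ 2 ^ m ≤ (δ₁ ^ 2 ^ k) ^ 2 ^ m := by
    rw [← pow_mul, ← pow_add]; exact h1.trans h
  exact (pow_le_pow_iff_left₀ (gowersPower_nonneg hk g) (by positivity) (by positivity)).mp h2

/-- **The non-degenerate case** (`|J| = k ≥ 2` private coordinates): the bound of
`SplitSys.coreGvN_concrete` transported back to `ℤ_{N'}^d` and rooted.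
[cite: GreenTao2010, App. C (Main argument)] -/
theorem box_nondegenerate {s k d' : ℕ} (hk2 : 2 ≤ k) (hks : k ≤ s + 1) (Sp : Splitting d k d')
    {Ψ : Fin t → AffLinForm d} (hfc : IsFiniteComplexitySystem Ψ) (hnd : IsNondegenerateSystem Ψ)
    {i₁ : Fin t} (htop : ∏ e ∈ Sp.J, (Ψ i₁).coeff e ≠ 0)
    (hlow : ∀ i, i ≠ i₁ → ∏ e ∈ Sp.J, (Ψ i).coeff e = 0)
    {N : ℝ} {L : ℕ} (hL1 : 1 ≤ L) (hsize : affLinSize Ψ N ≤ L) (hp : N'.Prime) (hLN : L < N')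
    {D₀ : ℕ} {η : ℝ} (hη : 0 ≤ η) {ν₀ : ZMod N' → ℝ} (hν₀ : ∀ x, 0 ≤ ν₀ x)
    (hLFC : LinearFormsCondition D₀ D₀ D₀ η ν₀) (hD : coreDegree k d' t L ≤ D₀)
    {g : Fin t → ZMod N' → ℝ} (hg : ∀ i x, |g i x| ≤ ν₀ x)
    {δ₁ : ℝ} (hδ : 0 ≤ δ₁) (hgow : gowersPower (s + 1) (g i₁) ≤ δ₁ ^ 2 ^ (s + 1))
    {χ : Fin d → ZMod N' → ℝ} (hχ : ∀ e x, |χ e x| ≤ 1) :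
    |𝔼 n : Fin d → ZMod N', (∏ i, g i ((Ψ i).modEval N' n)) * ∏ e, χ e (n e)| ≤
      (1 + η) * (δ₁ + ((1 + η) * (4 * η)) ^ ((2 ^ (k + 1) : ℕ) : ℝ)⁻¹) := by
  have hk : 1 ≤ k := by omega
  set S := splitOf Ψ i₁ Sp with hS
  -- transport the average to split coordinates
  have htrans : (𝔼 n : Fin d → ZMod N', (∏ i, g i ((Ψ i).modEval N' n)) * ∏ e, χ e (n e)) =
      𝔼 p : SplitIdx k d' → ZMod N', (∏ i, g i (S.θ N' i p)) * ∏ v, χ (Sp.σ.symm v) (p v) := by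
    rw [expect_comp_splitting Sp]
    refine Finset.expect_congr rfl fun p _ => ?_
    congr 1
    · refine Fintype.prod_congr _ _ fun i => ?_
      rw [hS, ← splitOf_θ Ψ i₁ Sp N' i (fun e => p (Sp.σ e))]
      have : (fun v => p (Sp.σ (Sp.σ.symm v))) = p := funext fun v => by simp
      rw [this]
    · exact Fintype.prod_equiv Sp.σ _ _ fun e => by simp
  rw [htrans]
  have hcore := S.coreGvN_concrete hk2 (splitOf_fc hfc i₁ Sp) (splitOf_nz hnd i₁ Sp)
    (splitOf_top Sp htop) (splitOf_low Sp hlow) hL1 (splitOf_bound hsize i₁ Sp)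
    (splitOf_isUnit Sp htop hsize hp hLN) hη hν₀ hLFC hD hg (χ := fun v => χ (Sp.σ.symm v))
    fun v x => hχ _ _
  -- `‖g_{i₁}‖_{U^k}^{2^k} ≤ δ₁^{2^k}`
  have hgk : gowersPower k (g i₁) ≤ δ₁ ^ 2 ^ k := gowersPower_le_of_le hk hks hδ hgow
  -- root
  set w : ℝ := ((1 + η) * (4 * η)) ^ ((2 ^ (k + 1) : ℕ) : ℝ)⁻¹ with hw
  have hw0 : 0 ≤ w := Real.rpow_nonneg (by positivity) _
  have hwpow : w ^ 2 ^ k = Real.sqrt ((1 + η) * (4 * η)) := by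
    have h2 : (2 ^ (k + 1) : ℕ) = 2 ^ k * 2 := by rw [pow_succ]
    rw [hw, h2, Real.sqrt_eq_rpow]
    rw [← Real.rpow_natCast, ← Real.rpow_mul (by positivity)]
    congr 1
    push_cast
    have : (2 : ℝ) ^ k ≠ 0 := by positivity
    field_simp
  have hB : (gowersPower k (g i₁) + Real.sqrt ((1 + η) * (4 * η))) * (1 + η) ^ (2 ^ k - 1) ≤
      ((1 + η) * (δ₁ + w)) ^ 2 ^ k := by
    rw [mul_pow]
    have h1 : gowersPower k (g i₁) + Real.sqrt ((1 + η) * (4 * η)) ≤ (δ₁ + w) ^ 2 ^ k := by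
      calc gowersPower k (g i₁) + Real.sqrt ((1 + η) * (4 * η)) ≤ δ₁ ^ 2 ^ k + w ^ 2 ^ k := by
            rw [hwpow]; exact add_le_add hgk le_rfl
        _ ≤ (δ₁ + w) ^ 2 ^ k := pow_add_pow_le hδ hw0 (by positivity)
    have h2 : (1 + η) ^ (2 ^ k - 1) ≤ (1 + η) ^ 2 ^ k :=
      pow_le_pow_right₀ (by linarith) (Nat.sub_le _ _)
    calc (gowersPower k (g i₁) + Real.sqrt ((1 + η) * (4 * η))) * (1 + η) ^ (2 ^ k - 1)
        ≤ (δ₁ + w) ^ 2 ^ k * (1 + η) ^ 2 ^ k :=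
          mul_le_mul h1 h2 (by positivity) (by positivity)
      _ = (1 + η) ^ 2 ^ k * (δ₁ + w) ^ 2 ^ k := mul_comm _ _
  exact (pow_le_pow_iff_left₀ (abs_nonneg _) (by positivity) (by positivity)).mp (hcore.trans hB)

omit [NeZero N'] in
/-- The value of a form at a point with one coordinate changed. [folklore] -/
theorem modEval_update (ψ : AffLinForm d) (n : Fin d → ZMod N') (e₀ : Fin d) (y : ZMod N') :
    ψ.modEval N' (Function.update n e₀ y) = ψ.modEval N' n + (ψ.coeff e₀ : ZMod N') * (y - n e₀) := by
  unfold AffLinForm.modEval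
  rw [← Finset.add_sum_erase _ _ (Finset.mem_univ e₀),
    ← Finset.add_sum_erase _ (fun j => (ψ.coeff j : ZMod N') * n j) (Finset.mem_univ e₀),
    Function.update_self]
  have : ∑ j ∈ Finset.univ.erase e₀, (ψ.coeff j : ZMod N') * Function.update n e₀ y j =
      ∑ j ∈ Finset.univ.erase e₀, (ψ.coeff j : ZMod N') * n j :=
    Finset.sum_congr rfl fun j hj => by rw [Function.update_of_ne (Finset.ne_of_mem_erase hj)]
  rw [this]; ring

/-- **The degenerate case** (a single private coordinate `e₀`: `ψ̇_{i₁}(e₀) ≠ 0` and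
`ψ̇_i(e₀) = 0` for `i ≠ i₁`): the average factors, the `e₀`-average is a correlation of
`g_{i₁}` along a unit-step progression with a smoothed cutoff, controlled by `‖g_{i₁}‖_{U²}`
(`expect_affine_mul_apSmooth_pow_four_le`), and the remaining average of the majorants is
`≤ 1 + η` by the linear forms condition. [folklore] -/
theorem box_degenerate {s : ℕ} (hs : 1 ≤ s) {Ψ : Fin t → AffLinForm d}
    (hfc : IsFiniteComplexitySystem Ψ) (hnd : IsNondegenerateSystem Ψ) {i₁ : Fin t} {e₀ : Fin d}
    (htop : (Ψ i₁).coeff e₀ ≠ 0) (hlow : ∀ i, i ≠ i₁ → (Ψ i).coeff e₀ = 0)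
    {N : ℝ} {L : ℕ} (hsize : affLinSize Ψ N ≤ L) (hp : N'.Prime) (hLN : L < N')
    {D₀ : ℕ} {η : ℝ} (hη : 0 ≤ η) {ν₀ : ZMod N' → ℝ}
    (hLFC : LinearFormsCondition D₀ D₀ D₀ η ν₀) (htD : t ≤ D₀) (hdD : d ≤ D₀) (hLD : L ≤ D₀)
    (hd1 : 1 ≤ d)
    {g : Fin t → ZMod N' → ℝ} (hg : ∀ i x, |g i x| ≤ ν₀ x)
    {δ₁ : ℝ} (hδ : 0 ≤ δ₁) (hgow : gowersPower (s + 1) (g i₁) ≤ δ₁ ^ 2 ^ (s + 1))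
    {c : Fin d → ZMod N' → ℝ} (hc : ∀ e x, |c e x| ≤ 1) {q : ℕ} (hq : 1 ≤ q) (hqN : q ≤ N') :
    |𝔼 n : Fin d → ZMod N', (∏ i, g i ((Ψ i).modEval N' n)) * ∏ e, apSmooth (c e) 1 q (n e)| ≤
      (1 + η) * (((N' : ℝ) / q) ^ (1 / 4 : ℝ) * δ₁) := by
  -- the factorisation
  set a : ZMod N' := ((Ψ i₁).coeff e₀ : ZMod N') with ha
  have hunit : IsUnit a := by
    refine isUnit_intCast_of_prime hp htop ?_
    have := natAbs_coeff_le_of_affLinSize_le hsize i₁ e₀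
    rw [Int.abs_eq_natAbs]
    exact_mod_cast lt_of_le_of_lt this hLN
  set R : (Fin d → ZMod N') → ℝ := fun n =>
    (∏ i ∈ Finset.univ.erase i₁, g i ((Ψ i).modEval N' n)) *
      ∏ e ∈ Finset.univ.erase e₀, apSmooth (c e) 1 q (n e) with hR
  set Sn : (Fin d → ZMod N') → ℝ := fun n => 𝔼 y : ZMod N',
    g i₁ (a * y + ((Ψ i₁).modEval N' n - a * n e₀)) * apSmooth (c e₀) 1 q y with hSn
  have hfac : (𝔼 n : Fin d → ZMod N', (∏ i, g i ((Ψ i).modEval N' n)) *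
      ∏ e, apSmooth (c e) 1 q (n e)) = 𝔼 n : Fin d → ZMod N', R n * Sn n := by
    rw [← expect_expect_update e₀ (fun n : Fin d → ZMod N' => (∏ i, g i ((Ψ i).modEval N' n)) *
      ∏ e, apSmooth (c e) 1 q (n e))]
    refine Finset.expect_congr rfl fun n _ => ?_
    rw [hSn, Finset.mul_expect]
    refine Finset.expect_congr rfl fun y _ => ?_
    rw [← Finset.mul_prod_erase _ _ (Finset.mem_univ i₁),
      ← Finset.mul_prod_erase _ _ (Finset.mem_univ e₀), Function.update_self]
    have h1 : ∏ i ∈ Finset.univ.erase i₁, g i ((Ψ i).modEval N' (Function.update n e₀ y)) =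
        ∏ i ∈ Finset.univ.erase i₁, g i ((Ψ i).modEval N' n) :=
      Finset.prod_congr rfl fun i hi => by
        rw [modEval_update, hlow i (Finset.ne_of_mem_erase hi)]; simp
    have h2 : ∏ e ∈ Finset.univ.erase e₀, apSmooth (c e) 1 q (Function.update n e₀ y e) =
        ∏ e ∈ Finset.univ.erase e₀, apSmooth (c e) 1 q (n e) :=
      Finset.prod_congr rfl fun e he => by rw [Function.update_of_ne (Finset.ne_of_mem_erase he)]
    have h3 : (Ψ i₁).modEval N' (Function.update n e₀ y) = a * y + ((Ψ i₁).modEval N' n - a * n e₀) := by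
      rw [modEval_update]; ring
    rw [h1, h2, h3, hR]
    ring
  rw [hfac]
  -- the bound on the inner average
  have hS : ∀ n, |Sn n| ≤ ((N' : ℝ) / q) ^ (1 / 4 : ℝ) * δ₁ := by
    intro n
    have h4 := expect_affine_mul_apSmooth_pow_four_le (g i₁) (hc e₀) hunit
      ((Ψ i₁).modEval N' n - a * n e₀) hq hqN
    have hg2 : gowersPower 2 (g i₁) ≤ δ₁ ^ 2 ^ 2 := gowersPower_le_of_le (by norm_num) (by omega) hδ hgow
    have h5 : (Sn n) ^ 4 ≤ (((N' : ℝ) / q) ^ (1 / 4 : ℝ) * δ₁) ^ 4 := by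
      refine h4.trans ?_
      rw [mul_pow, show ((2 : ℕ) ^ 2) = 4 by norm_num] at *
      have : (((N' : ℝ) / q) ^ (1 / 4 : ℝ)) ^ 4 = (N' : ℝ) / q := by
        rw [one_div]
        exact Real.rpow_inv_natCast_pow (by positivity) (by norm_num)
      rw [this]
      exact mul_le_mul_of_nonneg_left hg2 (by positivity)
    have hb : 0 ≤ ((N' : ℝ) / q) ^ (1 / 4 : ℝ) * δ₁ := mul_nonneg (Real.rpow_nonneg (by positivity) _) hδ
    have h7 : |Sn n| ^ 4 ≤ (((N' : ℝ) / q) ^ (1 / 4 : ℝ) * δ₁) ^ 4 := by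
      rw [pow_abs, abs_of_nonneg (by positivity : (0 : ℝ) ≤ Sn n ^ 4)]; exact h5
    exact (pow_le_pow_iff_left₀ (a := |Sn n|) (b := ((N' : ℝ) / q) ^ (1 / 4 : ℝ) * δ₁)
      (abs_nonneg (Sn n)) hb (by norm_num : (4 : ℕ) ≠ 0)).mp h7
  -- the bound on the outer average
  have hRabs : ∀ n, |R n| ≤ ∏ i ∈ Finset.univ.erase i₁, ν₀ ((Ψ i).modEval N' n) := by
    intro n
    rw [hR, abs_mul, Finset.abs_prod, Finset.abs_prod]
    calc (∏ i ∈ Finset.univ.erase i₁, |g i ((Ψ i).modEval N' n)|) *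
          ∏ e ∈ Finset.univ.erase e₀, |apSmooth (c e) 1 q (n e)|
        ≤ (∏ i ∈ Finset.univ.erase i₁, ν₀ ((Ψ i).modEval N' n)) * 1 :=
          mul_le_mul (Finset.prod_le_prod (fun _ _ => abs_nonneg _) fun _ _ => hg _ _)
            (Finset.prod_le_one (fun _ _ => abs_nonneg _) fun e _ => abs_apSmooth_le (hc e) _ hq _)
            (by positivity) (Finset.prod_nonneg fun i _ => (abs_nonneg _).trans (hg i _))
      _ = _ := mul_one _
  have hER : (𝔼 n : Fin d → ZMod N', ∏ i ∈ Finset.univ.erase i₁, ν₀ ((Ψ i).modEval N' n)) ≤ 1 + η := by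
    rcases (Finset.univ.erase i₁).eq_empty_or_nonempty with h0 | hne
    · rw [h0]; simp only [Finset.prod_empty, Fintype.expect_const]; linarith
    · set T := Finset.univ.erase i₁ with hT
      let e : Fin T.card ≃ T := (finCongr (Fintype.card_coe T).symm).trans (Fintype.equivFin T).symm
      have hinj : Function.Injective (fun i : Fin T.card => (e i).1) :=
        fun i j hij => e.injective (Subtype.ext hij)
      have hTD : T.card ≤ D₀ := (Finset.card_le_univ T).trans (by rw [Fintype.card_fin]; exact htD)
      have h := hLFC d T.card hd1 hdD hne.card_pos hTD _ (hnd.comp_of_injective hinj)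
        (fun i j hij a b hab => hfc _ _ (fun hh => hij (hinj hh)) a b hab) fun i j => by
          have := natAbs_coeff_le_of_affLinSize_le hsize (e i).1 j
          show |(Ψ (e i).1).coeff j| ≤ (D₀ : ℤ)
          rw [Int.abs_eq_natAbs]; exact_mod_cast this.trans hLD
      rw [linearFormsAverage_comp_eq ν₀ Ψ T e] at h
      linarith [(abs_le.mp h).2]
  calc |𝔼 n : Fin d → ZMod N', R n * Sn n|
      ≤ 𝔼 n : Fin d → ZMod N', |R n| * (((N' : ℝ) / q) ^ (1 / 4 : ℝ) * δ₁) :=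
        (Finset.abs_expect_le _ _).trans (Finset.expect_le_expect fun n _ => by
          rw [abs_mul]; exact mul_le_mul_of_nonneg_left (hS n) (abs_nonneg _))
    _ = (𝔼 n : Fin d → ZMod N', |R n|) * (((N' : ℝ) / q) ^ (1 / 4 : ℝ) * δ₁) := by
        rw [← Finset.expect_mul]
    _ ≤ (1 + η) * (((N' : ℝ) / q) ^ (1 / 4 : ℝ) * δ₁) :=
        mul_le_mul_of_nonneg_right ((Finset.expect_le_expect fun n _ => hRabs n).trans hER)
          (by positivity)

/-- The error of the mollified multilinear average in terms of the Gowers bound `δ₁`, the linear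
forms error `η` and the smoothing ratio `R = N'/q`. [folklore] -/
def boxErr (s : ℕ) (η δ₁ R : ℝ) : ℝ :=
  2 * (δ₁ + (8 * η) ^ ((2 ^ (s + 2) : ℕ) : ℝ)⁻¹) + 2 * (R ^ (1 / 4 : ℝ) * δ₁)

/-- `boxErr ≥ 0`. [folklore] -/
theorem boxErr_nonneg (s : ℕ) {η δ₁ R : ℝ} (hη : 0 ≤ η) (hδ : 0 ≤ δ₁) (hR : 0 ≤ R) :
    0 ≤ boxErr s η δ₁ R := by
  unfold boxErr
  have : 0 ≤ (8 * η) ^ ((2 ^ (s + 2) : ℕ) : ℝ)⁻¹ := Real.rpow_nonneg (by positivity) _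
  have : 0 ≤ R ^ (1 / 4 : ℝ) := Real.rpow_nonneg hR _
  positivity

/-- A pseudorandomness degree sufficient for the mollified multilinear average bound.
[cite: GreenTao2010, Prop. 7.1 ("constants `C₁` and `D`, depending on `s,t,d` and `L`")] -/
def boxDegree (s t d L : ℕ) : ℕ := coreDegree (s + 1) d t L + t + d + L

/-- Comparing the roots: `((1+η)4η)^{1/2^{k+1}} ≤ (8η)^{1/2^{s+2}}` for `0 ≤ η ≤ 1/8`,
`k ≤ s + 1`. [folklore] -/
theorem root_le_root {η : ℝ} (hη : 0 ≤ η) (hη1 : η ≤ 1 / 8) {k s : ℕ} (hks : k ≤ s + 1) :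
    ((1 + η) * (4 * η)) ^ ((2 ^ (k + 1) : ℕ) : ℝ)⁻¹ ≤ (8 * η) ^ ((2 ^ (s + 2) : ℕ) : ℝ)⁻¹ := by
  have hbase : (1 + η) * (4 * η) ≤ 8 * η := by nlinarith
  rcases eq_or_lt_of_le hη with h0 | hpos
  · rw [← h0]; simp
  · calc ((1 + η) * (4 * η)) ^ ((2 ^ (k + 1) : ℕ) : ℝ)⁻¹
        ≤ (8 * η) ^ ((2 ^ (k + 1) : ℕ) : ℝ)⁻¹ :=
          Real.rpow_le_rpow (by positivity) hbase (by positivity)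
      _ ≤ (8 * η) ^ ((2 ^ (s + 2) : ℕ) : ℝ)⁻¹ := by
          refine Real.rpow_le_rpow_of_exponent_ge (by positivity) (by linarith) ?_
          refine inv_anti₀ (by positivity) ?_
          exact_mod_cast Nat.pow_le_pow_right (by norm_num) (by omega)

/-- **The mollified multilinear average bound** (Green–Tao 2010, App. C, Proposition 7.1″ with
smooth product cutoffs in place of the Lipschitz cutoff `F`): for `Ψ` in `s`-normal form
(standing hypotheses, `‖Ψ‖ ≤ L < N'`, `N'` prime), `|g_i| ≤ ν`, `ν` satisfying the
`(D,D,D)`-linear forms condition with error `η ≤ 1/8` for `D ≥ boxDegree`, cutoffs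
`χ_e = c_e ∗ μ_q ∗ μ_{-q}` (`|c_e| ≤ 1`, `1 ≤ q ≤ N'`), and `‖g_{i₁}‖_{U^{s+1}(ℤ_{N'})} ≤ δ₁`:
`|𝔼_n ∏_i g_i(ψ_i(n)) ∏_e χ_e(n_e)| ≤ boxErr s η δ₁ (N'/q)`. The two cases of the proof are the
main argument of App. C (`|J| ≥ 2`) and a degenerate one (`|J| ≤ 1`, one private coordinate,
treated by factorisation). [cite: GreenTao2010, App. C (Proposition 7.1″)] -/
theorem box_bound {s : ℕ} (hs : 1 ≤ s) {Ψ : Fin t → AffLinForm d} (hnd : IsNondegenerateSystem Ψ)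
    (hnf : IsNormalForm s Ψ) (i₁ : Fin t)
    {N : ℝ} {L : ℕ} (hL1 : 1 ≤ L) (hsize : affLinSize Ψ N ≤ L) (hp : N'.Prime) (hLN : L < N')
    (hd1 : 1 ≤ d)
    {D₀ : ℕ} {η : ℝ} (hη : 0 ≤ η) (hη1 : η ≤ 1 / 8) {ν₀ : ZMod N' → ℝ} (hν₀ : ∀ x, 0 ≤ ν₀ x)
    (hLFC : LinearFormsCondition D₀ D₀ D₀ η ν₀) (hD : boxDegree s t d L ≤ D₀)
    {g : Fin t → ZMod N' → ℝ} (hg : ∀ i x, |g i x| ≤ ν₀ x)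
    {δ₁ : ℝ} (hδ : 0 ≤ δ₁) (hgow : gowersPower (s + 1) (g i₁) ≤ δ₁ ^ 2 ^ (s + 1))
    {c : Fin d → ZMod N' → ℝ} (hc : ∀ e x, |c e x| ≤ 1) {q : ℕ} (hq : 1 ≤ q) (hqN : q ≤ N') :
    |𝔼 n : Fin d → ZMod N', (∏ i, g i ((Ψ i).modEval N' n)) * ∏ e, apSmooth (c e) 1 q (n e)| ≤
      boxErr s η δ₁ ((N' : ℝ) / q) := by
  have hfc : IsFiniteComplexitySystem Ψ := hnf.isFiniteComplexitySystem
  have hDc : coreDegree (s + 1) d t L ≤ D₀ := by unfold boxDegree at hD; omega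
  have htD : t ≤ D₀ := by unfold boxDegree at hD; omega
  have hdD : d ≤ D₀ := by unfold boxDegree at hD; omega
  have hLD : L ≤ D₀ := by unfold boxDegree at hD; omega
  have hR0 : 0 ≤ ((N' : ℝ) / q) ^ (1 / 4 : ℝ) * δ₁ := mul_nonneg (Real.rpow_nonneg (by positivity) _) hδ
  have hroot0 : 0 ≤ (8 * η) ^ ((2 ^ (s + 2) : ℕ) : ℝ)⁻¹ := Real.rpow_nonneg (by positivity) _
  obtain ⟨J, hJcard, hJtop, hJlow⟩ := hnf i₁
  by_cases h2 : 2 ≤ J.card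
  · -- the main case
    obtain ⟨Sp, hSp⟩ := exists_splitting J
    have htop' : ∏ e ∈ Sp.J, (Ψ i₁).coeff e ≠ 0 := by rw [hSp]; exact hJtop
    have hlow' : ∀ i, i ≠ i₁ → ∏ e ∈ Sp.J, (Ψ i).coeff e = 0 := by rw [hSp]; exact hJlow
    have hχ : ∀ e x, |apSmooth (c e) 1 q x| ≤ 1 := fun e x => abs_apSmooth_le (hc e) _ hq _
    have h := box_nondegenerate h2 hJcard Sp hfc hnd htop' hlow' hL1 hsize hp hLN hη hν₀ hLFC
      ((coreDegree_mono hJcard (Nat.sub_le d J.card)).trans hDc) hg hδ hgow hχ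
    refine h.trans ?_
    unfold boxErr
    have h1 : ((1 + η) * (4 * η)) ^ ((2 ^ (J.card + 1) : ℕ) : ℝ)⁻¹ ≤
        (8 * η) ^ ((2 ^ (s + 2) : ℕ) : ℝ)⁻¹ := root_le_root hη hη1 hJcard
    nlinarith
  · -- the degenerate case: one private coordinate
    push Not at h2
    obtain ⟨e₀, he₀top, he₀low⟩ : ∃ e₀, (Ψ i₁).coeff e₀ ≠ 0 ∧ ∀ i, i ≠ i₁ → (Ψ i).coeff e₀ = 0 := by
      rcases Nat.lt_or_ge J.card 1 with h0 | h1
      · -- `J = ∅`: then `t = 1` effectively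
        have hJ : J = ∅ := Finset.card_eq_zero.mp (by omega)
        have hall : ∀ i, i = i₁ := by
          intro i; by_contra hi
          have := hJlow i hi
          rw [hJ, Finset.prod_empty] at this
          exact one_ne_zero this
        obtain ⟨e₀, he₀⟩ : ∃ e₀, (Ψ i₁).coeff e₀ ≠ 0 := by
          by_contra h; push Not at h
          exact hnd.1 i₁ (funext h)
        exact ⟨e₀, he₀, fun i hi => absurd (hall i) hi⟩
      · have hJ1 : J.card = 1 := by omega
        obtain ⟨e₀, hJ⟩ := Finset.card_eq_one.mp hJ1
        refine ⟨e₀, ?_, fun i hi => ?_⟩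
        · have := hJtop; rw [hJ, Finset.prod_singleton] at this; exact this
        · have := hJlow i hi; rw [hJ, Finset.prod_singleton] at this; exact this
    have h := box_degenerate hs hfc hnd he₀top he₀low hsize hp hLN hη hLFC htD hdD hLD hd1 hg hδ
      hgow hc hq hqN
    refine h.trans ?_
    unfold boxErr
    nlinarith

end boxlemma

end Literature.NumberTheory.Sieve
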